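import Mathlib
import Summits.Ventures.PercRepro2.IFRTail

/-!
# Log-concave weights and the likelihood-ratio order (seat mine-b, cell pub-perc-repro2)

The one-dimensional ingredients of the bundle step of the two-dimensional tail calculus
(Tail2DBundle.lean): positive log-concave weights `y₀, …, y_c` (`IsLCW`, with the balanced-pair lemma),
the bundle convolution `bconv y c T a b = Σ_{i=0}^{c} y_i · T(a - i, b - (c - i))`, and the theorem
`lr_conv`: the likelihood-ratio order of two sequences (`q m' * p m ≤ q m * p m'` for `m ≤ m'`) is preserved
by the convolution with `y` — the 2×2 Cauchy–Binet identity of IFRTail.lean with both minors signed.  This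
is the lattice form of the classical fact that PF₂ convolutions preserve the likelihood-ratio order
(Karlin, Total Positivity; Barlow–Proschan, Ch. 4).
-/

open Finset

namespace Summit.Ventures.PercRepro2.Tail2D

/-- log-concave positive weights on `[0, c]`, zero outside -/
structure IsLCW (y : ℤ → ℝ) (c : ℤ) : Prop where
  pos : ∀ i, 0 ≤ i → i ≤ c → 0 < y i
  zero : ∀ i, i < 0 ∨ c < i → y i = 0
  lc : ∀ i, 1 ≤ i → i + 1 ≤ c → y (i - 1) * y (i + 1) ≤ y i * y i

namespace IsLCW

variable {y : ℤ → ℝ} {c : ℤ} (hy : IsLCW y c)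

include hy

/-- the weights are non-negative -/
lemma nonneg (i : ℤ) : 0 ≤ y i := by
  by_cases h : 0 ≤ i ∧ i ≤ c
  · exact (hy.pos i h.1 h.2).le
  · rw [hy.zero i (by omega)]

/-- balanced pairs: for `i ≤ j`, `y i * y (j + 1) ≤ y (i + 1) * y j` (the ratio `y (k+1) / y k` is
non-increasing). -/
lemma balanced {i j : ℤ} (h : i ≤ j) : y i * y (j + 1) ≤ y (i + 1) * y j := by
  obtain ⟨d, rfl⟩ : ∃ d : ℕ, j = i + d := ⟨(j - i).toNat, by omega⟩
  induction d with
  | zero => simp; exact le_of_eq (mul_comm _ _)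
  | succ d ih =>
    have ih := ih (by omega)
    set j := i + (d : ℤ) with hj
    have e1 : i + ((d + 1 : ℕ) : ℤ) = j + 1 := by rw [hj]; push_cast; ring
    rw [e1]
    by_cases hi : y i = 0
    · rw [hi, zero_mul]; exact mul_nonneg (hy.nonneg _) (hy.nonneg _)
    by_cases hj2 : y (j + 1 + 1) = 0
    · rw [hj2, mul_zero]; exact mul_nonneg (hy.nonneg _) (hy.nonneg _)
    -- both ends positive: everything in between lies in `[0, c]`
    have hi0 : 0 ≤ i := by
      by_contra hc; exact hi (hy.zero i (Or.inl (by omega)))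
    have hj2c : j + 1 + 1 ≤ c := by
      by_contra hc; exact hj2 (hy.zero (j + 1 + 1) (Or.inr (by omega)))
    have hlc : y (j + 1 - 1) * y (j + 1 + 1) ≤ y (j + 1) * y (j + 1) := hy.lc (j + 1) (by omega) (by omega)
    rw [show j + 1 - 1 = j by ring] at hlc
    have pj : 0 < y j := hy.pos j (by omega) (by omega)
    have pj1 : 0 < y (j + 1) := hy.pos (j + 1) (by omega) (by omega)
    have key : y i * y (j + 1 + 1) * (y j * y (j + 1)) ≤ y (i + 1) * y (j + 1) * (y j * y (j + 1)) := by
      calc y i * y (j + 1 + 1) * (y j * y (j + 1)) = (y i * y (j + 1)) * (y j * y (j + 1 + 1)) := by ring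
        _ ≤ (y (i + 1) * y j) * (y (j + 1) * y (j + 1)) :=
            mul_le_mul ih hlc (mul_nonneg (hy.nonneg _) (hy.nonneg _)) (mul_nonneg (hy.nonneg _) (hy.nonneg _))
        _ = y (i + 1) * y (j + 1) * (y j * y (j + 1)) := by ring
    exact le_of_mul_le_mul_right key (mul_pos pj pj1)

end IsLCW

/-- the bundle convolution `T' a b = Σ_{i ∈ [0, c]} y i * T (a - i) (b - (c - i))` -/
noncomputable def bconv (y : ℤ → ℝ) (c : ℤ) (T : ℤ → ℤ → ℝ) (a b : ℤ) : ℝ :=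
  ∑ i ∈ Finset.Icc 0 c, y i * T (a - i) (b - (c - i))

section LR

variable {y : ℤ → ℝ} {c : ℤ} (hy : IsLCW y c)

/-- a sum over `[0, c]` equals the sum over `[-1, c]` when the summand vanishes at `-1` -/
lemma sum_extend (f : ℤ → ℝ) (h : f (-1) = 0) :
    ∑ i ∈ Finset.Icc 0 c, f i = ∑ i ∈ Finset.Icc (-1) c, f i := by
  apply Finset.sum_subset
  · intro x hx; simp only [Finset.mem_Icc] at hx ⊢; omega
  · intro x hx hx'; simp only [Finset.mem_Icc] at hx hx'
    have : x = -1 := by omega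
    rw [this, h]

include hy in
/-- shifted sum: `Σ_{[0,c]} y i * f (k + 1 - i) = Σ_{[-1,c]} y (i + 1) * f (k - i)` -/
lemma sum_shift_weights (f : ℤ → ℝ) (k : ℤ) :
    ∑ i ∈ Finset.Icc 0 c, y i * f (k + 1 - i) = ∑ i ∈ Finset.Icc (-1) c, y (i + 1) * f (k - i) := by
  have h1 : ∑ i ∈ Finset.Icc 0 c, y i * f (k + 1 - i) = ∑ i ∈ Finset.Icc (-1) (c - 1), y (i + 1) * f (k - i) := by
    refine Finset.sum_nbij' (fun i => i - 1) (fun i => i + 1) ?_ ?_ ?_ ?_ ?_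
    · intro x hx; simp only [Finset.mem_Icc] at hx ⊢; omega
    · intro x hx; simp only [Finset.mem_Icc] at hx ⊢; omega
    · intro x _; simp
    · intro x _; simp
    · intro x _; simp only [sub_add_cancel]; congr 2; ring
  rw [h1]
  apply Finset.sum_subset
  · intro x hx; simp only [Finset.mem_Icc] at hx ⊢; omega
  · intro x hx hx'; simp only [Finset.mem_Icc] at hx hx'
    have : x = c := by omega
    rw [this, hy.zero (c + 1) (Or.inr (by omega))]; ring

include hy in
/-- **likelihood-ratio order is preserved by a log-concave convolution**: if `q m' * p m ≤ q m * p m'` for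
all `m ≤ m'`, then the same holds for the convolutions `P k = Σ y i * p (k - i)`, `Q k = Σ y i * q (k - i)`
at consecutive indices: `Q (k+1) * P k ≤ Q k * P (k+1)`. -/
theorem lr_conv (p q : ℤ → ℝ) (hpq : ∀ m m', m ≤ m' → q m' * p m ≤ q m * p m') (k : ℤ) :
    (∑ i ∈ Finset.Icc 0 c, y i * q (k + 1 - i)) * (∑ i ∈ Finset.Icc 0 c, y i * p (k - i))
      ≤ (∑ i ∈ Finset.Icc 0 c, y i * q (k - i)) * (∑ i ∈ Finset.Icc 0 c, y i * p (k + 1 - i)) := by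
  have hz : y (-1) = 0 := hy.zero (-1) (Or.inl (by omega))
  rw [sum_shift_weights hy q k, sum_shift_weights hy p k,
    sum_extend (c := c) (fun i => y i * p (k - i)) (by rw [hz]; ring),
    sum_extend (c := c) (fun i => y i * q (k - i)) (by rw [hz]; ring)]
  set J := Finset.Icc (-1) c with hJ
  have cb := IFR.cauchy_binet_two J (fun i => y (i + 1)) (fun i => y i) (fun i => q (k - i)) (fun i => p (k - i))
  -- cb : (Σ y(i+1) q) * (Σ y p) - (Σ y(i+1) p) * (Σ y q) = Σ_{i<j} (...) * (...)
  have hsum : ∑ i ∈ J, ∑ j ∈ J.filter (fun j => i < j),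
      (y (i + 1) * y j - y (j + 1) * y i) * (q (k - i) * p (k - j) - q (k - j) * p (k - i)) ≤ 0 := by
    apply Finset.sum_nonpos; intro i _
    apply Finset.sum_nonpos; intro j hj
    have hij : i < j := (Finset.mem_filter.mp hj).2
    have h1 : 0 ≤ y (i + 1) * y j - y (j + 1) * y i := by
      have := hy.balanced (i := i) (j := j) hij.le; linarith
    have h2 : q (k - i) * p (k - j) - q (k - j) * p (k - i) ≤ 0 := by
      have := hpq (k - j) (k - i) (by omega); linarith
    have := mul_nonneg h1 (neg_nonneg.mpr h2)
    linarith
  linarith [cb, hsum]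

end LR

end Summit.Ventures.PercRepro2.Tail2D
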